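import Summits.QuantumFields.YangMills.Theorems.BalabanUVNodesN07SplitClauseHeadAtMeetCube
import Summits.QuantumFields.YangMills.Theorems.BalabanUVNodesN07MeetFamilyAtRecord
import Summits.QuantumFields.YangMills.Theorems.BalabanUVNodesN07DatumGauge152Guarded
import Summits.QuantumFields.YangMills.Theorems.BalabanUVNodesN07DPrimeHermitianLetter
import Summits.QuantumFields.YangMills.Theorems.BalabanUVNodesK0Stub1H128OfFlatSocket
import Literature.MathematicalPhysics.QuantumFieldTheory.Balaban1983to89.Node00.LocalGaugeCoDivergenceLetters
import Literature.MathematicalPhysics.QuantumFieldTheory.Balaban1983to89.B7Eq214FlatQprime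
import HarnessLib

/-!
# N07 [B11] ∕ K0⁷ road, chart side — MODULE 116b: **THE DATUM PACKAGE OF THE (d′)-Lam ASSEMBLY** — (i) at a MEETING datum of the record under MODULE 100's structural letters and guard
# conjuncts: `Adm22` of print's (150) family `D″ = cubeDomains ⊓ domainsOfSeq` and the window «`π(box)` lies over `Ω′_{K−n−1}`» (77c's prologue, packaged once); (ii) a bond read by an
# `SU(N)` unit through the gauge equation `U^u(b) = e^{iηA(b)}` with `η|A(b)|` small carries a Hermitian-traceless `A(b)` (MODULE 108 §1, packaged); (iii) the supplier's threshold arithmetic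

Cell `pub-ymgap`, seat `pub-ymgap-dag-n07-e` g30 (FAN-OUT §N07 row s3; LANE OWNER of the K0 road chart side); companion of MODULES 115 ∕ 116 ∕ 117 (`DPRIME-LAM-ROADMAP.md` §3).
`--kind proof --supports stmt-QuantumFields-20541 --as helper` (K0⁷); count-neutral; theorems only.  [15] = [Balaban1985Variational]; [6] = [Balaban1985RegularSpaces];
[4] = [Balaban1984PropagatorsII]; [3] = [Balaban1985Averaging].

WHAT IS PROVED (sorry-free; no definition; axioms standard).
§1 ★★ `adm22_and_window_of_meetDatum` — for a run `s : SeqOfRecord F ν M g K k` (`SeqSeparated ν.M₁ s`, `0 < ν.M₁`), the structural letters `M_h = L^{a′}`, `L·M_h ∣ ρ`, `R·L·M_h ≤ ρ`,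
`L ≤ ρ`, the guard facts `(11·4 + 4ρ + Mc + 3)·L ≤ c ≤ ν.M₁`, `Mc + 44 + 6ρ ≤ 2L^{c₀}`, `a′ + 1 ≤ c₀`, `k + c₀ ≤ m + K`, the grid numerics, a level `1 ≤ K − n ≤ k` and a MEETING datum `idx`:
`Adm22 D″ R (L·M_h)` ∧ `∀ x ∈ π(box), D″.InOm (K − n − 1) x` (`numerics_cornerP_of_levelGuard`, `adm22_meetCube_trunc_seqOfRecord`, `blockSat_seqOfRecord`, `cover_mem_Ω_pred_of_meet_box`,
`inOm_pred_meet_of_mem_box` — by name).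
§2 ★ `mem_herm0_of_gaugeEq` — `(ι∘U)^{ι∘u}(b) = e^{iηA(b)}`, `η‖A(b)‖ ≤ κε`, `2κε ≤ ρ_SU` ⟹ `A(b) ∈ herm0` (MODULE 108 §1 `I_eta_smul_mem_lieSU_of_expI_eq` + k0-s1 `inv_I_eta_smul_mem_herm0`).
§3 `thresholdFactor_eq`, ★ `threshold_lt` — the supplier's (MODULE 114) threshold expression at `d = 4` equals `η·(L⁸·M·2C₄)·r′²` for `ρ′ = η·r′`, hence lies strictly below `η·T·r′²`
whenever `L⁸·Mx·2C₄ < T`, `M ≤ Mx`, `r′ > 0`.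
HONEST FRAMING: bookkeeping by name + real arithmetic; NOTHING of [15]'s estimates asserted; (d′) ∕ `HThm4RecDbar` ∕ budget row of MODULE 100 untouched; K0⁷ NOT closed; N07 NOT
discharged; counts unmoved; one finite 𝕋⁴ programme at fixed ε — NOT continuum ∕ ℝ⁴ ∕ OS ∕ mass gap ∕ Clay.  No `sorry`, no `def`, no `instance`, no `notation`.

References: [15] (144) p.300, (150)–(153) p.301, (157)–(159) pp.302–303; [6] p.98, (1.131) p.99; [4] (2.1)–(2.3) p.224; [3] (21) p.21; [Balaban1987RG1] (0.1) p.251, (0.4) p.253.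
-/

set_option autoImplicit false

noncomputable section
open scoped BigOperators Matrix.Norms.L2Operator

namespace Summit.QuantumFields.YangMills.BalabanUVNodes.N07DPrimeDatumPackage

open Literature.MathematicalPhysics.QuantumFieldTheory.Balaban1983to89
open Literature.MathematicalPhysics.QuantumFieldTheory.Balaban1983to89.Node00
open Literature.MathematicalPhysics.QuantumFieldTheory.Balaban1983to89.B12RegularSpaces111 (gaugeU expI)
open B15Eq112TorusCover (cover)
open B14DomainGeom (Pt Within)
open B5Eq118OneStroke (iterBlockOf)
open B8Eq131Cubes (box)
open B9AdOrthogonal (herm0)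
open T4Continuum (T4Family)
open GaugeField (gaugeAct)
open Summit.QuantumFields.YangMills.Theorems.FlatCubeOpsText (Adm22)
open Summit.QuantumFields.YangMills.BalabanUVNodes.N07DPrimeHermitianLetter (coe_expI_eq_exp I_eta_smul_mem_lieSU_of_expI_eq)
open Summit.QuantumFields.YangMills.Theorems.K0Stub1H128OfFlatSocket (inv_I_eta_smul_mem_herm0)
open Summit.QuantumFields.YangMills.BalabanUVNodes.N07MeetFamilyAtRecord (adm22_meetCube_trunc_seqOfRecord cover_mem_Ω_pred_of_meet_box)
open Summit.QuantumFields.YangMills.BalabanUVNodes.N07DatumGauge152Guarded (numerics_cornerP_of_levelGuard)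
open Summit.QuantumFields.YangMills.BalabanUVNodes.N07RecordDomainsAdm22 (blockSat_seqOfRecord)
open Summit.QuantumFields.YangMills.BalabanUVNodes.N07SplitClauseHeadAtMeetCube (inOm_pred_meet_of_mem_box)

/-! ## §1  At a meeting datum: `Adm22 D″ R (L·M_h)` and the window over `Ω′_{K−n−1}` -/

/-- ★★ **THE DATUM PACKAGE** (77c's prologue, packaged once): at a MEETING datum of the record, under the structural letters and the guard's conjuncts, print's (150) family
`D″ = cubeDomains ⊓ domainsOfSeq s.Ω (K − n)` is admissible, `Adm22 D″ R (L·M_h)`, and every point of `π(box)` has level `≥ K − n − 1` in `D″`.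
[cite: Balaban1985Variational, (144) p.300, (150) p.301; Balaban1984PropagatorsII, (2.1)–(2.2) p.224; Balaban1985RegularSpaces, p.98, (1.131) p.99, (1.3)–(1.6) p.77] -/
theorem adm22_and_window_of_meetDatum (F : T4Family) (ν : Stage7Numerics) (M : ℕ) (g : ℕ → ℝ) (K k : ℕ) (s : SeqOfRecord F ν M g K k)
    (hsep : Sect2.SeqSeparated ν.M₁ s) (hM₁ : 0 < ν.M₁)
    {ρ Mc Mh R a' c c₀ : ℕ} (hMha : Mh = F.L ^ a') (hdvd : F.L * Mh ∣ ρ) (hRρ : R * (F.L * Mh) ≤ ρ) (hLρ : F.L ≤ ρ)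
    (hc : (11 * 4 + 4 * ρ + Mc + 3) * F.L ≤ c) (hc₀ : Mc + 11 * 4 + 6 * ρ ≤ 2 * F.L ^ c₀) (hac₀ : a' + 1 ≤ c₀) (hcν : c ≤ ν.M₁) (hlev : k + c₀ ≤ F.m + K)
    (hgrid : ∀ j : ℕ, 1 ≤ j → j ≤ k →
      F.L * Mh ∣ M * RkOfRecord (F.P K).L ν.r (g j) ∧ dCubeSide (F.P K).L M (RkOfRecord (F.P K).L ν.r (g j)) j ∣ (F.P K).sitesPerDir 0)
    {n : ℕ} (hk : K - n ≤ (F.P K).m + (F.P K).K) (hk1 : 1 ≤ K - n) (hjk : K - n ≤ k) (idx : Pt (F.P K).d)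
    (hmeet : ∃ x ∈ box (F.P K).L (cornerP (F.P K) Mc ρ idx) (sideP (F.P K) Mc ρ) (K - n), ∃ y : Pt (F.P K).d, cover (F.P K) y ∈ s.Ω (K - n) ∧ Within ((3 : ℕ) : ℤ) x y) :
    Adm22 (domainsMeet (cubeDomains (F.P K) (cornerP (F.P K) Mc ρ idx) (sideP (F.P K) Mc ρ) ρ (K - n) hk) (domainsOfSeq s.Ω (K - n) hk)) R (F.L * Mh) ∧
    ∀ x ∈ cover (F.P K) '' box (F.P K).L (cornerP (F.P K) Mc ρ idx) (sideP (F.P K) Mc ρ) (K - n),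
      (domainsMeet (cubeDomains (F.P K) (cornerP (F.P K) Mc ρ idx) (sideP (F.P K) Mc ρ) ρ (K - n) hk) (domainsOfSeq s.Ω (K - n) hk)).InOm (K - n - 1) x := by
  have hLn0 : 0 < F.L := by have := F.hL11; omega
  have hLρ' : (F.P K).L ≤ ρ := hLρ
  have hMhpos : 0 < Mh := by rw [hMha]; exact pow_pos hLn0 a'
  have hLMh : 1 ≤ F.L * Mh := Nat.mul_pos hLn0 hMhpos
  obtain ⟨ha, hM, hper, hinj⟩ := numerics_cornerP_of_levelGuard F hk1 hjk hlev hMha hac₀ hLρ' hdvd hc₀ idx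
  have hnest : ∀ i : ℕ, 1 ≤ i → i < K - n → s.Ω (i + 1) ⊆ s.Ω i := fun i h1 hi => s.chain.Ω_succ_subset_Ω h1 (lt_of_lt_of_le hi hjk)
  have hdiv : ∀ j' : ℕ, 1 ≤ j' → j' ≤ K - n → dCubeSide (F.P K).L M (RkOfRecord (F.P K).L ν.r (g j')) j' ∣ (F.P K).sitesPerDir 0 :=
    fun j' h1 hj' => (hgrid j' h1 (hj'.trans hjk)).2
  have hgran : ∀ j' : ℕ, 1 ≤ j' → j' ≤ K - n → F.L * Mh ∣ M * RkOfRecord (F.P K).L ν.r (g j') := fun j' h1 hj' => (hgrid j' h1 (hj'.trans hjk)).1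
  have hmK : (F.P K).m + (F.P K).K = F.m + K := rfl
  have hsat : ∀ (j' : ℕ) (x x' : Site (F.P K) 0), 1 ≤ j' → j' ≤ K - n → iterBlockOf j' x = iterBlockOf j' x' → x ∈ s.Ω j' → x' ∈ s.Ω j' :=
    fun j' x x' h1 hj' => blockSat_seqOfRecord F ν M g K k (by omega) s (fun i h1 hi => (hgrid i h1 hi).2) j' x x' h1 (hj'.trans hjk)
  have hν1 : 1 ≤ ν.M₁ := hM₁
  have hfloor : 11 * (F.P K).d + 2 * ρ + Mc + 3 ≤ ν.M₁ := by
    have hd : (F.P K).d = 4 := rfl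
    have : (11 * 4 + 4 * ρ + Mc + 3) ≤ (11 * 4 + 4 * ρ + Mc + 3) * F.L := Nat.le_mul_of_pos_right _ hLn0
    rw [hd]; omega
  have hbox' : 2 ≤ K - n → ∀ z ∈ box (F.P K).L (cornerP (F.P K) Mc ρ idx) (sideP (F.P K) Mc ρ) (K - n), cover (F.P K) z ∈ s.Ω (K - n - 1) :=
    fun h2 => cover_mem_Ω_pred_of_meet_box F ν M g K k s hν1 hsep hfloor h2 hjk hmeet
  have hRsep : R * (F.L * Mh) + 1 ≤ (F.P K).L * ν.M₁ := by
    have hLP : (F.P K).L = F.L := rfl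
    have h1 : ν.M₁ ≤ F.L * ν.M₁ := Nat.le_mul_of_pos_left _ hLn0
    have h2 : ρ + 1 ≤ c := by
      have : (11 * 4 + 4 * ρ + Mc + 3) ≤ (11 * 4 + 4 * ρ + Mc + 3) * F.L := Nat.le_mul_of_pos_right _ hLn0
      omega
    rw [hLP]; omega
  exact ⟨adm22_meetCube_trunc_seqOfRecord F ν M g K k s hjk hk hLMh hν1 hRsep hsep hdiv hgran hdvd ha hM hper hRρ,
    inOm_pred_meet_of_mem_box s.Ω hinj hk1 hnest hsat hbox'⟩

/-! ## §2  A bond read through the gauge equation carries a Hermitian-traceless potential -/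

/-- ★ **`A(b)` IS HERMITIAN TRACELESS UNDER THE GAUGE EQUATION** `(ι∘U)^{ι∘u}(b) = e^{iηA(b)}` with `η‖A(b)‖ ≤ κε`, `2κε ≤ ρ_SU` (MODULE 108 §1: `iηA(b) = log U^u(b) ∈ 𝔰𝔲(N)`; the winding
budget `κε ≤ ρ_SU∕2 ≤ 1∕6 < log 2`). [cite: Balaban1985Averaging, (21) p.21; Balaban1985Variational, (152) p.301, (159) p.303] -/
theorem mem_herm0_of_gaugeEq {P : Params} {N : ℕ} [NeZero N] {η κε : ℝ} (hη0 : 0 < η) (hκε : 2 * κε ≤ rhoSU N)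
    (u : GaugeTransf P 0 (SU N)) (U : GaugeField P 0 (SU N)) (A : PBond P 0 → MatA N) {b : PBond P 0}
    (he : gaugeU (fun x => ιSU N (u x)) (fun b' => ιSU N (U b')) b = expI η (A b)) (hsz : η * ‖A b‖ ≤ κε) : A b ∈ herm0 (Fin N) := by
  have hthird := rhoSU_le_third (N := N)
  have hκε1 : κε ≤ 1 := by linarith only [hκε, hthird]
  have hIη : (Complex.I * (η : ℂ)) ≠ 0 := mul_ne_zero Complex.I_ne_zero (Complex.ofReal_ne_zero.2 hη0.ne')
  have hnorm : ‖(Complex.I * (η : ℂ)) • A b‖ = η * ‖A b‖ := by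
    rw [norm_smul, norm_mul, Complex.norm_I, one_mul, Complex.norm_real, Real.norm_eq_abs, abs_of_pos hη0]
  have hsmall : ‖(Complex.I * (η : ℂ)) • A b‖ ≤ κε := hnorm ▸ hsz
  have hlog : ‖(Complex.I * (η : ℂ)) • A b‖ < Real.log 2 := by
    have : κε < Real.log 2 := by linarith only [hκε, hthird, Real.log_two_gt_d9]
    exact hsmall.trans_lt this
  have hgauge : ((ιSU N (gaugeAct u U b) : (MatA N)ˣ) : MatA N) = ((expI η (A b) : (MatA N)ˣ) : MatA N) := by
    rw [ιSU_gaugeAct]; exact congrArg Units.val he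
  have hρN : ‖((gaugeAct u U b : SU N) : MatA N) - 1‖ ≤ rhoSU N := by
    rw [← coe_ιSU N, hgauge, coe_expI_eq_exp]
    exact (B7Eq214FlatQprime.norm_exp_sub_one_le_two_mul hsmall hκε1).trans hκε
  have hlie := I_eta_smul_mem_lieSU_of_expI_eq η (A b) (gaugeAct u U b) hgauge hlog hρN
  have h := inv_I_eta_smul_mem_herm0 (η := η) hlie
  rwa [smul_smul, inv_mul_cancel₀ hIη, one_smul] at h

/-! ## §3  The supplier's threshold arithmetic at `d = 4` -/

/-- The supplier's threshold factor at `d = 4` is `η⁻¹`: `c²·η⁴·η⁻¹·(η⁻¹)² = η⁻¹` for `c·η = 1`. [folklore] -/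
theorem thresholdFactor_eq {c η : ℝ} (hη : η ≠ 0) (hcη : c * η = 1) : c ^ 2 * η ^ 4 * η⁻¹ * η⁻¹ ^ 2 = η⁻¹ := by
  have hc : c = η⁻¹ := eq_inv_of_mul_eq_one_left hcη
  subst hc
  field_simp

/-- ★ **THE SUPPLIER's THRESHOLD IS MET** (MODULE 114's `t`-hypothesis at `d = 4`, `ρ′ = η·r′`): `L8·(M·((2·(c²η⁴η⁻¹))·(η⁻¹)²·C₄)·ρ′²) < η·(T·r′²)` whenever `M ≤ Mx`, `0 ≤ C₄`,
`0 ≤ L8`, `L8·Mx·(2C₄) < T`, `r′ > 0`. [cite: Balaban1985Variational, (158) p.302, (165) p.304 (bookkeeping)] -/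
theorem threshold_lt {L8 M₀ Mx C₄ c η ρ' r' T : ℝ} (hη : 0 < η) (hcη : c * η = 1) (hMx : M₀ ≤ Mx) (hC₄ : 0 ≤ C₄) (hL8 : 0 ≤ L8)
    (hρ' : ρ' = η * r') (hr' : 0 < r') (hT : L8 * Mx * (2 * C₄) < T) :
    L8 * (M₀ * ((2 * (c ^ 2 * η ^ 4 * η⁻¹) * η⁻¹ ^ 2 * C₄) * ρ' ^ 2)) < η * (T * r' ^ 2) := by
  have hfac := thresholdFactor_eq hη.ne' hcη
  have hexpr : L8 * (M₀ * ((2 * (c ^ 2 * η ^ 4 * η⁻¹) * η⁻¹ ^ 2 * C₄) * ρ' ^ 2)) = η * (L8 * M₀ * (2 * C₄) * r' ^ 2) := by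
    have e : (2 * (c ^ 2 * η ^ 4 * η⁻¹) * η⁻¹ ^ 2 * C₄) = 2 * C₄ * η⁻¹ := by
      rw [show (2 * (c ^ 2 * η ^ 4 * η⁻¹) * η⁻¹ ^ 2 * C₄) = 2 * C₄ * (c ^ 2 * η ^ 4 * η⁻¹ * η⁻¹ ^ 2) by ring, hfac]
    rw [e, hρ']
    field_simp
  rw [hexpr]
  refine mul_lt_mul_of_pos_left ?_ hη
  have h1 : L8 * M₀ * (2 * C₄) ≤ L8 * Mx * (2 * C₄) := mul_le_mul_of_nonneg_right (mul_le_mul_of_nonneg_left hMx hL8) (by positivity)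
  have h3 : 0 < r' ^ 2 := by positivity
  nlinarith only [h1, hT, h3]

end Summit.QuantumFields.YangMills.BalabanUVNodes.N07DPrimeDatumPackage

end
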